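import Summits.QuantumFields.YangMills.Theorems.BalabanUVNodesN15TwoGridLandauGreenDict
import Summits.QuantumFields.YangMills.Theorems.BalabanUVNodesN18KingModelTorusDeriv
import Literature.MathematicalPhysics.QuantumFieldTheory.King1986.MinimizerDecayUniform
import Literature.MathematicalPhysics.QuantumFieldTheory.King1986.MinimizerTwoSpacingDerivUniform
import HarnessLib

/-!
# Route «BalabanUVNodes», node N15 = NE2, -a lane, part 51: DOOR (iv) — KING's PROP. 3.8 (3.71) LINES 1–2 AT `m² = 0` (mass-uniform constants of the tree + CONTINUITY OF THE
# MINIMISER IN THE MASS), the input of part 52's hypothesis-free entry 0 of `𝔇(G′, G)` for Bałaban's full Landau-gauge propagator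

Cell `pub-ymgap`, seat `pub-ymgap-dag-n15-a` (KNIT-BY-NAME, g12); `--supports stmt-QuantumFields-20290 --as helper`; `HOME/pub-ymgap-dag-n15-a/DOOR-IV-PLAN.md` §7 (route R).
Over part 50 (`KRe_torIdx_eq_minimiser`, `DKRe_torIdx_eq_minimiser`, `reM_greenOp_eq_fineOp`, `isReal_greenOp`), part 49 (`hasMaj_twoGridDefect_of_kernelPairRates`), King's typed two-spacing
theorems with MASS-UNIFORM constants (`King1986.MinimizerDecayUniform.king_prop38_torus_blocks_unif` = (3.71) line 1, `…MinimizerTwoSpacingDerivUniform.king_prop38_deriv_torus_blocks_unif` =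
line 2, for King's `minimiser` with `a_k = aK a L k`, `c = n²`, `0 < m² ≤ m₀²`), n18's uniform outer constants (`N18KingModelTorus.outerRate_le_unif`, `…TorusDeriv.douterRate_le_unif`),
King's (2.13) algebra (`EffectiveLaplacianRate.inv_aK_add`: `a_{k+m}⁻¹ = a_k⁻¹ + L^{−2k}a_m⁻¹`; `CovarianceRateTorus.aminL_le_aK`), b05's `isUnit_greenOp`, and the (1.126) engine's decays.
WHAT.  (§54) `fineOp a c m² = fineOp a c 0 + m²·1`; `det (fineOp n M a n² 0) ≠ 0` (it is `Re` of Bałaban's invertible `Δ + aQ′*Q′`); ★ `continuousAt_minimiser_mass`: King's minimiser kernel is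
CONTINUOUS IN THE MASS at `m² = 0` (`continuousAt_matrix_inv`); `abs_le_of_Ioc` (a bound uniform on `(0, m₀²]` passes to `m² = 0`).  (§55) ★★ `king_line1_massless` ∕ `king_line2_massless`:
(3.71) lines 1–2 for King's minimiser AT `m² = 0`, uniform on the torus family of record (`C·(L^k)^{−γ∕2}·e^{−δ|B(x)−b|_T}`, all `m_T`, `k ≥ 1`, `m ≥ 1`).  (§56–§57 = part 52: the read-out for `K_T`∕`∂K_T` and the hypothesis-free entry 0.)
HONEST FRAMING ∕ LIMITS.  `U ≡ 1` linear theory on finite tori (the torus family of record `M_μ = 2L^{m_T}`, `n = L^k`); entry 0 only (entries 1–3 of (3.42) and the node readout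
`NE2ZeroOperator` NOT here); the rate exponent is King's `γ∕2` halved again by the geometric means of the lineage — immaterial for NE2's «some γ > 0»; constants crude and ours; Bałaban's
inequalities enter only through the tree's theorems (`prop12_famG_printed`, the (1.126) engine, b04∕b05's kernels) and King's through the tree's `King1986.*`; count-neutral (typed 28∕28 ·
discharged 5∕28 unchanged); NOT a discharge of N15 (object-bound: Node 00's [B9] operator layer of record; NE2⁺ NOT PRINTED); one finite T⁴ at fixed ε — NOT infinite volume, NOT OS on ℝ⁴,
NOT a mass gap, NOT Clay.
-/

noncomputable section

open scoped BigOperators Matrix Topology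
open Finset Filter

namespace Summit.QuantumFields.YangMills.BalabanUVNodes.N15.TwoGrid

open Literature.MathematicalPhysics.QuantumFieldTheory.Balaban1983to89
open Literature.MathematicalPhysics.QuantumFieldTheory.Balaban1983to89.B11SectG (BlockNorm HasMaj)
open Literature.MathematicalPhysics.QuantumFieldTheory.Balaban1983to89.T4EtaRateCoeffDefect (pull fibre mem_fibre)
open Literature.MathematicalPhysics.QuantumFieldTheory.Balaban1983to89.T4EtaRateDefect (idef)
open Literature.MathematicalPhysics.QuantumFieldTheory.Balaban1983to89.B5Prop11Plancherel (Tor fine unitVec)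
open Literature.MathematicalPhysics.QuantumFieldTheory.Balaban1983to89.B5Action121 (LapS)
open Literature.MathematicalPhysics.QuantumFieldTheory.Balaban1983to89.B5Block118 (QsOp)
open Literature.MathematicalPhysics.QuantumFieldTheory.Balaban1983to89.B5Hk160Torus (QsAdj)
open Literature.MathematicalPhysics.QuantumFieldTheory.Balaban1983to89.B5RealFields (IsReal reM reM_one)
open Literature.MathematicalPhysics.QuantumFieldTheory.Balaban1983to89.B5PBridgeGreenInverse (greenOp_mul_inv)
open Literature.MathematicalPhysics.QuantumFieldTheory.Balaban1983to89.B5SiteBridgeP12 (MP)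
open Literature.MathematicalPhysics.QuantumFieldTheory.Balaban1983to89.B4Sect5Torus (tdist tdist_nonneg)
open Literature.MathematicalPhysics.QuantumFieldTheory.Balaban1983to89.B4TorusKernel (periodConst)
open Literature.MathematicalPhysics.QuantumFieldTheory.Balaban1983to89.B4TorusKernel.MultiPeriod (torusSupNorm)
open Literature.MathematicalPhysics.QuantumFieldTheory.Balaban1983to89.B5QGGQ145Bounds (Idx toZ)
open Literature.MathematicalPhysics.QuantumFieldTheory.Balaban1983to89.B5QGGQ145Factor (KRe KRe_decay)
open Literature.MathematicalPhysics.QuantumFieldTheory.Balaban1983to89.B5DPD126Uniform (DKRe cIdx toZ_cIdx tdist_eq_torusSupNorm DKRe_decay)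
open Literature.MathematicalPhysics.QuantumFieldTheory.Balaban1983to89.B5PBridgeProjection (torIdx torIdx_apply)
open Literature.MathematicalPhysics.QuantumFieldTheory.King1986 (aK aK_pos inv_aK_add prop38RateConst prop38PosConst dprop38RateConst dprop38PosConst lemma43Const)
open Literature.MathematicalPhysics.QuantumFieldTheory.King1986.Torus (blockOf tdistT tdistT_nonneg lapF fineOp minimiser Qmat aminL aminL_pos aminL_le_aK
  king_prop38_torus_blocks_unif king_prop38_deriv_torus_blocks_unif)
open Literature.MathematicalPhysics.QuantumFieldTheory.Balaban1983to89.B6UnitTorusCarrier (unitTorusGeo)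
open Summit.QuantumFields.YangMills.BalabanUVNodes.N15.VectorPiece (blkFine kingPr kingPrV kingPr_val)
open Summit.QuantumFields.YangMills.BalabanUVNodes.N18KingModelTorus (outerRate_le_unif)
open Summit.QuantumFields.YangMills.BalabanUVNodes.N18KingModelTorusDeriv (douterRate_le_unif)

variable {d : ℕ}

/-! ## §54 The minimiser is continuous in the mass at `m² = 0`; uniform bounds on `(0, m₀²]` pass to `m² = 0` -/

section Mass

variable (M : Fin (d + 1) → ℕ) [∀ μ, NeZero (M μ)] (n : ℕ) [NeZero n]

/-- `A₀(a, c, m²) = A₀(a, c, 0) + m²·1` (the mass enters the stencil (4.4) only on the diagonal). [cite: King1986, (4.4) p.670] -/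
theorem fineOp_eq_add_mass (a c m2 : ℝ) : fineOp n M a c m2 = fineOp n M a c 0 + m2 • (1 : Matrix (Tor (fine n M)) (Tor (fine n M)) ℝ) := by
  ext z z'
  simp only [fineOp, lapF, Matrix.add_apply, Matrix.smul_apply, Matrix.one_apply, smul_eq_mul]
  rcases eq_or_ne z' z with h | h
  · rw [if_pos h, if_pos h.symm]; ring
  · rw [if_neg h, if_neg (Ne.symm h)]; ring

/-- `det A₀(a, n², 0) ≠ 0`: the massless fine operator is the real part of Bałaban's invertible `Δ + aQ′*Q′` (part 50 + b05 `isUnit_greenOp`). [cite: Balaban1984PropagatorsI, p.25 («its inverse is a bounded operator G′»)] -/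
theorem isUnit_det_fineOp_zero {a : ℝ} (ha : 0 < a) : IsUnit (fineOp n M a ((n : ℝ) ^ 2) 0).det := by
  classical
  rw [← reM_greenOp_eq_fineOp]
  have hR := isReal_greenOp M n a
  have h1 : reM (LapS (fine n M) (n : ℂ) + (a : ℂ) • (QsAdj n M * QsOp n M)) * reM (LapS (fine n M) (n : ℂ) + (a : ℂ) • (QsAdj n M * QsOp n M))⁻¹ = 1 := by
    rw [← hR.reM_mul hR.inv, greenOp_mul_inv n M ha, reM_one]
  exact Matrix.isUnit_det_of_right_inverse h1

/-- ★ **KING's MINIMISER KERNEL IS CONTINUOUS IN THE MASS AT `m² = 0`** (`c = n²`, `a > 0`): `m² ↦ minimiser n M a (n²) m² φ x` is continuous at `0` (the matrix inverse is continuous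
at the invertible massless operator). [cite: King1986, (2.13)–(2.15) p.653] -/
theorem continuousAt_minimiser_mass {a : ℝ} (ha : 0 < a) (φ : Tor M → ℝ) (x : Tor (fine n M)) :
    ContinuousAt (fun m2 : ℝ => minimiser n M a ((n : ℝ) ^ 2) m2 φ x) 0 := by
  classical
  have haff : Continuous fun m2 : ℝ => fineOp n M a ((n : ℝ) ^ 2) 0 + m2 • (1 : Matrix (Tor (fine n M)) (Tor (fine n M)) ℝ) :=
    continuous_const.add (continuous_id.smul continuous_const)
  have hinv : ContinuousAt (fun A : Matrix (Tor (fine n M)) (Tor (fine n M)) ℝ => A⁻¹) (fineOp n M a ((n : ℝ) ^ 2) 0) := by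
    refine continuousAt_matrix_inv _ ?_
    obtain ⟨u, hu⟩ := isUnit_det_fineOp_zero M n ha
    rw [← hu]
    exact NormedRing.inverse_continuousAt u
  have hF : ContinuousAt (fun m2 : ℝ => (fineOp n M a ((n : ℝ) ^ 2) m2)⁻¹) 0 := by
    have e : (fun m2 : ℝ => (fineOp n M a ((n : ℝ) ^ 2) m2)⁻¹) = (fun A : Matrix (Tor (fine n M)) (Tor (fine n M)) ℝ => A⁻¹) ∘
        fun m2 : ℝ => fineOp n M a ((n : ℝ) ^ 2) 0 + m2 • (1 : Matrix (Tor (fine n M)) (Tor (fine n M)) ℝ) := by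
      funext m2
      show _ = (fineOp n M a ((n : ℝ) ^ 2) 0 + m2 • (1 : Matrix (Tor (fine n M)) (Tor (fine n M)) ℝ))⁻¹
      rw [← fineOp_eq_add_mass]
    rw [e]
    refine ContinuousAt.comp ?_ haff.continuousAt
    simpa using hinv
  have hentry : ContinuousAt (fun m2 : ℝ => ((fineOp n M a ((n : ℝ) ^ 2) m2)⁻¹ *ᵥ ((Qmat n M)ᵀ *ᵥ φ)) x) 0 := by
    have hlin : Continuous fun A : Matrix (Tor (fine n M)) (Tor (fine n M)) ℝ => (A *ᵥ ((Qmat n M)ᵀ *ᵥ φ)) x := by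
      simp only [Matrix.mulVec, dotProduct]
      exact continuous_finsetSum Finset.univ fun j _ => (continuous_apply_apply x j).mul continuous_const
    exact hlin.continuousAt.comp hF
  simp only [minimiser, Pi.smul_apply, smul_eq_mul]
  exact continuousAt_const.mul hentry

omit [∀ μ, NeZero (M μ)] [NeZero n] in
/-- a bound holding for all masses in `(0, m₀²]` holds at `m² = 0` for a quantity continuous in the mass there. [folklore] -/
theorem abs_le_of_Ioc {g : ℝ → ℝ} {m0sq B : ℝ} (hm0 : 0 < m0sq) (hg : ContinuousAt g 0) (h : ∀ m2, 0 < m2 → m2 ≤ m0sq → |g m2| ≤ B) : |g 0| ≤ B := by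
  have ht : Tendsto (fun m2 => |g m2|) (𝓝[>] 0) (𝓝 |g 0|) :=
    ((continuous_abs.continuousAt).comp hg).tendsto.mono_left nhdsWithin_le_nhds
  refine le_of_tendsto ht ?_
  filter_upwards [Ioc_mem_nhdsGT hm0] with m2 hm2
  exact h m2 hm2.1 hm2.2

end Mass


/-! ## §55 ★★ King's Prop. 3.8 (3.71) lines 1–2 at `m² = 0` on the torus family of record -/

section KingMassless

variable {L : ℕ} [NeZero L]

omit [NeZero L] in
/-- the unit torus of record IS King's volume `sitesPerDir K = 2L^{m_T}`. [cite: Balaban1987RG1, (0.1) p.251] -/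
theorem eq_sitesPerDir_of_eq (mT k : ℕ) (hL : Odd L ∧ 1 < L) {M : Fin (d + 1) → ℕ} (hM : ∀ μ, M μ = 2 * L ^ mT) (μ : Fin (d + 1)) :
    M μ = (paramsOf d L mT k hL).sitesPerDir (paramsOf d L mT k hL).K := by
  rw [hM μ]; simp [paramsOf, Params.sitesPerDir]

omit [NeZero L] in
/-- `(L^{−c})^k = (L^k)^{−c}`. [folklore] -/
theorem rpow_neg_pow_eq (c : ℝ) (k : ℕ) : ((L : ℝ) ^ (-c)) ^ k = ((L ^ k : ℕ) : ℝ) ^ (-c) := by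
  have hL : (0 : ℝ) ≤ (L : ℝ) := Nat.cast_nonneg L
  rw [← Real.rpow_natCast, ← Real.rpow_mul hL, Nat.cast_pow, ← Real.rpow_natCast, ← Real.rpow_mul hL, mul_comm]

/-- ★★ **KING's (3.71) LINE 1 AT `m² = 0`**: for odd `L ≥ 3`, `a > 0`, `0 ≤ γ ≤ 1` there are `C, δ > 0` such that for every member (`m_T`, `k ≥ 1`) of the torus family of record, every refinement
`m ≥ 1`, every fine point `x′` (over `x = pr x′`) and unit site `b`: `|ℋ_{k+m}(x′, b) − ℋ_k(x, b)| ≤ C·(L^k)^{−γ∕2}·e^{−δ|B(x) − b|_T}` for the MASSLESS minimisers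
`ℋ_j = minimiser (L^j) M a_j (L^{2j}) 0 δ_b` — the tree's mass-uniform `king_prop38_torus_blocks_unif` on `(0, 1]` + `outerRate_le_unif`, passed to `m² = 0` by `continuousAt_minimiser_mass`.
[cite: King1986, Prop. 3.8 (3.71) p.664 (first line), §4 pp.672–674] -/
theorem king_line1_massless (hLodd : Odd L) (hL2 : 2 ≤ L) {a : ℝ} (ha : 0 < a) {γ : ℝ} (hγ0 : 0 ≤ γ) (hγ1 : γ ≤ 1) :
    ∃ C δ : ℝ, 0 < C ∧ 0 < δ ∧ ∀ (mT k m : ℕ) (hk : 1 ≤ k) (_hm : 1 ≤ m) (hL : Odd L ∧ 1 < L) (M : Fin (d + 1) → ℕ) [∀ μ, NeZero (M μ)]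
      (_hM : ∀ μ, M μ = 2 * L ^ mT) (x' : Tor (fine (L ^ m * L ^ k) M)) (b : Tor M),
      |minimiser (L ^ m * L ^ k) (M) (aK a L (k + m)) (((L ^ m * L ^ k : ℕ) : ℝ) ^ 2) 0 (Pi.single b 1) x'
          - minimiser (L ^ k) (M) (aK a L k) (((L ^ k : ℕ) : ℝ) ^ 2) 0 (Pi.single b 1) (kingPr L k m (M) x')|
        ≤ C * ((L ^ k : ℕ) : ℝ) ^ (-(γ / 2)) * Real.exp (-(δ * tdistT (M) (blockOf (L ^ k) (M) (kingPr L k m (M) x')) b)) := by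
  obtain ⟨δ₀, c₀, hδ₀, hc₀, H⟩ := king_prop38_torus_blocks_unif (d + 1) L (Nat.succ_pos d) hLodd hL2 ha (m0sq := 1) zero_le_one hγ0 hγ1
  set Cu : ℝ := prop38RateConst a a (a * (2 * ((a * (1 - ((L : ℝ) ^ 2)⁻¹))⁻¹ + Real.pi ^ 2 / 48 + 1 / 3))) ((Real.pi ^ 2 / 4) ^ (d + 1)) (d + 1) γ
      + prop38PosConst a ((Real.pi ^ 2 / 4) ^ (d + 1)) (d + 1) γ with hCu
  refine ⟨Real.sqrt (2 * (a * c₀) * Cu) + 1, δ₀ / 2, by positivity, half_pos hδ₀, fun mT k m hk hm hL M _ hM x' b => ?_⟩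
  haveI : NeZero (paramsOf d L mT k hL).L := ‹NeZero L›
  haveI : NeZero (L ^ m * L ^ k) := ⟨Nat.mul_ne_zero (pow_ne_zero _ (NeZero.ne L)) (pow_ne_zero _ (NeZero.ne L))⟩
  have haK : 0 < aK a L k := aK_pos ha (by exact_mod_cast hL.2) hk
  have haK' : 0 < aK a L (k + m) := aK_pos ha (by exact_mod_cast hL.2) (by omega)
  -- the mass-uniform bound on `(0, 1]`
  have hbound : ∀ m2 : ℝ, 0 < m2 → m2 ≤ 1 →
      |minimiser (L ^ m * L ^ k) (M) (aK a L (k + m)) (((L ^ m * L ^ k : ℕ) : ℝ) ^ 2) m2 (Pi.single b 1) x'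
          - minimiser (L ^ k) (M) (aK a L k) (((L ^ k : ℕ) : ℝ) ^ 2) m2 (Pi.single b 1) (kingPr L k m (M) x')|
        ≤ (Real.sqrt (2 * (a * c₀) * Cu) + 1) * ((L ^ k : ℕ) : ℝ) ^ (-(γ / 2))
          * Real.exp (-(δ₀ / 2 * tdistT (M) (blockOf (L ^ k) (M) (kingPr L k m (M) x')) b)) := by
    intro m2 hm2 hcap
    have hj := H (paramsOf d L mT k hL) rfl rfl hk m2 hm2 hcap m hm M (eq_sitesPerDir_of_eq mT k hL hM)
      (kingPr L k m (M) x') x' b (kingPr_val L k m (M) x')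
    have hC := outerRate_le_unif (d := d + 1) (Nat.succ_pos d) ha hL2 hk hm hγ1 hc₀.le (K := k) (n := m)
    have hE := Real.exp_nonneg (-(δ₀ / 2 * tdistT (M) (blockOf (L ^ k) (M) (kingPr L k m (M) x')) b))
    refine hj.trans ((mul_le_mul_of_nonneg_right hC hE).trans ?_)
    rw [rpow_neg_pow_eq]
    have hr : 0 ≤ ((L ^ k : ℕ) : ℝ) ^ (-(γ / 2)) := Real.rpow_nonneg (Nat.cast_nonneg _) _
    exact mul_le_mul_of_nonneg_right (mul_le_mul_of_nonneg_right (by linarith) hr) hE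
  -- continuity in the mass at `m² = 0`
  have hcont : ContinuousAt (fun m2 : ℝ => minimiser (L ^ m * L ^ k) (M) (aK a L (k + m)) (((L ^ m * L ^ k : ℕ) : ℝ) ^ 2) m2 (Pi.single b 1) x'
      - minimiser (L ^ k) (M) (aK a L k) (((L ^ k : ℕ) : ℝ) ^ 2) m2 (Pi.single b 1) (kingPr L k m (M) x')) 0 :=
    (continuousAt_minimiser_mass (M) (L ^ m * L ^ k) haK' (Pi.single b 1) x').sub
      (continuousAt_minimiser_mass (M) (L ^ k) haK (Pi.single b 1) (kingPr L k m (M) x'))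
  exact abs_le_of_Ioc one_pos hcont hbound

/-- ★★ **KING's (3.71) LINE 2 AT `m² = 0`**: the same for the forward lattice derivatives `n′(ℋ′(x′ + e′_μ) − ℋ′(x′)) − n(ℋ(x + e_μ) − ℋ(x))` (`0 ≤ γ < 1`; `king_prop38_deriv_torus_blocks_unif` +
`douterRate_le_unif` + continuity in the mass). [cite: King1986, Prop. 3.8 (3.71) p.664 (second line), §4 pp.672–674] -/
theorem king_line2_massless (hLodd : Odd L) (hL2 : 2 ≤ L) {a : ℝ} (ha : 0 < a) {γ : ℝ} (hγ0 : 0 ≤ γ) (hγ1 : γ < 1) :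
    ∃ C δ : ℝ, 0 < C ∧ 0 < δ ∧ ∀ (mT k m : ℕ) (hk : 1 ≤ k) (_hm : 1 ≤ m) (hL : Odd L ∧ 1 < L) (M : Fin (d + 1) → ℕ) [∀ μ, NeZero (M μ)]
      (_hM : ∀ μ, M μ = 2 * L ^ mT) (x' : Tor (fine (L ^ m * L ^ k) M)) (b : Tor M) (μ : Fin (d + 1)),
      |((L ^ m * L ^ k : ℕ) : ℝ)
          * (minimiser (L ^ m * L ^ k) (M) (aK a L (k + m)) (((L ^ m * L ^ k : ℕ) : ℝ) ^ 2) 0 (Pi.single b 1)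
              (x' + unitVec (fine (L ^ m * L ^ k) (M)) μ)
            - minimiser (L ^ m * L ^ k) (M) (aK a L (k + m)) (((L ^ m * L ^ k : ℕ) : ℝ) ^ 2) 0 (Pi.single b 1) x')
        - ((L ^ k : ℕ) : ℝ)
          * (minimiser (L ^ k) (M) (aK a L k) (((L ^ k : ℕ) : ℝ) ^ 2) 0 (Pi.single b 1)
              (kingPr L k m (M) x' + unitVec (fine (L ^ k) (M)) μ)
            - minimiser (L ^ k) (M) (aK a L k) (((L ^ k : ℕ) : ℝ) ^ 2) 0 (Pi.single b 1) (kingPr L k m (M) x'))|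
        ≤ C * ((L ^ k : ℕ) : ℝ) ^ (-(γ / 2)) * Real.exp (-(δ * tdistT (M) (blockOf (L ^ k) (M) (kingPr L k m (M) x')) b)) := by
  obtain ⟨δ₀, c₀, hδ₀, hc₀, H⟩ := king_prop38_deriv_torus_blocks_unif (d + 1) L (Nat.succ_pos d) hLodd hL2 ha (m0sq := 1) zero_le_one hγ0 hγ1
  set Cu : ℝ := dprop38RateConst a a (a * (2 * ((a * (1 - ((L : ℝ) ^ 2)⁻¹))⁻¹ + Real.pi ^ 2 / 48 + 1 / 3))) ((Real.pi ^ 2 / 4) ^ (d + 1)) (d + 1) γ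
      + dprop38PosConst a ((Real.pi ^ 2 / 4) ^ (d + 1)) (d + 1) γ with hCu
  refine ⟨Real.sqrt (2 * (a * c₀) * Cu) + 1, δ₀ / 2, by positivity, half_pos hδ₀, fun mT k m hk hm hL M _ hM x' b μ => ?_⟩
  haveI : NeZero (paramsOf d L mT k hL).L := ‹NeZero L›
  haveI : NeZero (L ^ m * L ^ k) := ⟨Nat.mul_ne_zero (pow_ne_zero _ (NeZero.ne L)) (pow_ne_zero _ (NeZero.ne L))⟩
  have haK : 0 < aK a L k := aK_pos ha (by exact_mod_cast hL.2) hk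
  have haK' : 0 < aK a L (k + m) := aK_pos ha (by exact_mod_cast hL.2) (by omega)
  have hbound : ∀ m2 : ℝ, 0 < m2 → m2 ≤ 1 →
      |((L ^ m * L ^ k : ℕ) : ℝ)
          * (minimiser (L ^ m * L ^ k) (M) (aK a L (k + m)) (((L ^ m * L ^ k : ℕ) : ℝ) ^ 2) m2 (Pi.single b 1)
              (x' + unitVec (fine (L ^ m * L ^ k) (M)) μ)
            - minimiser (L ^ m * L ^ k) (M) (aK a L (k + m)) (((L ^ m * L ^ k : ℕ) : ℝ) ^ 2) m2 (Pi.single b 1) x')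
        - ((L ^ k : ℕ) : ℝ)
          * (minimiser (L ^ k) (M) (aK a L k) (((L ^ k : ℕ) : ℝ) ^ 2) m2 (Pi.single b 1)
              (kingPr L k m (M) x' + unitVec (fine (L ^ k) (M)) μ)
            - minimiser (L ^ k) (M) (aK a L k) (((L ^ k : ℕ) : ℝ) ^ 2) m2 (Pi.single b 1) (kingPr L k m (M) x'))|
        ≤ (Real.sqrt (2 * (a * c₀) * Cu) + 1) * ((L ^ k : ℕ) : ℝ) ^ (-(γ / 2))
          * Real.exp (-(δ₀ / 2 * tdistT (M) (blockOf (L ^ k) (M) (kingPr L k m (M) x')) b)) := by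
    intro m2 hm2 hcap
    have hj := H (paramsOf d L mT k hL) rfl rfl hk m2 hm2 hcap m hm M (eq_sitesPerDir_of_eq mT k hL hM)
      (kingPr L k m (M) x') x' b (kingPr_val L k m (M) x') μ
    have hC := douterRate_le_unif (d := d + 1) (Nat.succ_pos d) ha hL2 hk hm hγ1 hc₀.le (K := k) (n := m)
    have hE := Real.exp_nonneg (-(δ₀ / 2 * tdistT (M) (blockOf (L ^ k) (M) (kingPr L k m (M) x')) b))
    refine hj.trans ((mul_le_mul_of_nonneg_right hC hE).trans ?_)
    rw [rpow_neg_pow_eq]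
    have hr : 0 ≤ ((L ^ k : ℕ) : ℝ) ^ (-(γ / 2)) := Real.rpow_nonneg (Nat.cast_nonneg _) _
    exact mul_le_mul_of_nonneg_right (mul_le_mul_of_nonneg_right (by linarith) hr) hE
  have hc1 := continuousAt_minimiser_mass (M) (L ^ m * L ^ k) haK' (Pi.single b 1)
  have hc2 := continuousAt_minimiser_mass (M) (L ^ k) haK (Pi.single b 1)
  have hcont : ContinuousAt (fun m2 : ℝ => ((L ^ m * L ^ k : ℕ) : ℝ)
          * (minimiser (L ^ m * L ^ k) (M) (aK a L (k + m)) (((L ^ m * L ^ k : ℕ) : ℝ) ^ 2) m2 (Pi.single b 1)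
              (x' + unitVec (fine (L ^ m * L ^ k) (M)) μ)
            - minimiser (L ^ m * L ^ k) (M) (aK a L (k + m)) (((L ^ m * L ^ k : ℕ) : ℝ) ^ 2) m2 (Pi.single b 1) x')
        - ((L ^ k : ℕ) : ℝ)
          * (minimiser (L ^ k) (M) (aK a L k) (((L ^ k : ℕ) : ℝ) ^ 2) m2 (Pi.single b 1)
              (kingPr L k m (M) x' + unitVec (fine (L ^ k) (M)) μ)
            - minimiser (L ^ k) (M) (aK a L k) (((L ^ k : ℕ) : ℝ) ^ 2) m2 (Pi.single b 1) (kingPr L k m (M) x'))) 0 :=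
    (continuousAt_const.mul ((hc1 _).sub (hc1 _))).sub (continuousAt_const.mul ((hc2 _).sub (hc2 _)))
  exact abs_le_of_Ioc one_pos hcont hbound

end KingMassless

end Summit.QuantumFields.YangMills.BalabanUVNodes.N15.TwoGrid
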